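import Summits.ABC.IUTFork.Conditional.WRowLicenceTripleEventuallySharp
import Summits.ABC.IUTFork.Cor312HullLicenceLabelZero
import Summits.ABC.IUTFork.LDHGenuinePerImageSlotConstant
import HarnessLib

/-!
# Branch C «abc ⇐ S», reading (U): the SHARP LEVEL CUT junctions — at the Frey point `λ = a/c` of an abc triple (`j ≠ 1728`),
# beyond `4·√(abc) + 4` or beyond every odd bad prime `p` and its `4·p^{⌊v_p(abc)/2⌋}`, the (U) binder CONCLUSIONS of the books
# of record are THEOREMS (abc-iut cell, branch C, row «C-LEVELCUT-SHARP», file 1; seat abc-iut-C-cert-2 gen 7)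

Record-only PROOF file (D-0012; 0 definitions, 0 `Prop` facts, nothing re-typed) of the abc-iut cell. TAKES NO SIDE on [IUTchIII]
Cor. 3.12 (S. Mochizuki, *Inter-universal Teichmüller theory III*, Cor. 3.12 p. 173–174; Step (xi-f) p. 184), on [IUTchIV] Thm. 1.10,
on (U)/(P), or on any author; «inhabited as typed» ≠ «asserted in print».

This seat's `Conditional/WRowLicenceTripleEventuallySharp` (gen 6, p508140) proved, for EVERY abc triple `(a, b, c)` with `j(a/c) ≠ 1728`
and every genuine Θ-volume datum `T` of `(λ = a/c, l)`: `T.Cor312Of` (reading (U)) and the (xi-f) licence of OUR sharp K-level setting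
for every pair of realising ideles, at every prime `l ≥ 5` with `p < l ∧ 4·p^{⌊v_p(abc)/2⌋} < l` for every odd prime `p ∣ abc`
(`WRow.cor312Of_triple_of_primePow_lt`, `WRow.licence_triple_of_primePow_lt`), in particular at every prime `l ≥ 4·Nat.sqrt(abc) + 5`
(`WRow.cor312Of_triple_eventually_sqrt`, `WRow.hcell_triple_of_sq_lt`). The books of record quantify their binders over ALL points
`P ∈ U_X` and ALL primes `l ≥ 5`; a SHARP LEVEL CUT inserts into a binder the ONE antecedent

  «`∀ a b c, IsABCTriple a b c → j(a/c) ≠ 1728 → P = ratPoint (a/c) →`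
   ` l ≤ 4·Nat.sqrt(abc) + 4 ∧ ∃ p prime, p ∣ abc ∧ p ≠ 2 ∧ l ≤ max p (4·p^{⌊v_p(abc)/2⌋})`»

— i.e. at the Frey point of an abc triple the binder is demanded ONLY at the primes below BOTH thresholds. This file proves the three
junctions that close the complement BY NAME (nothing restated):

* **`SharpCutU.cor312Of_of_not_sharp`** — off the cut, `T.Cor312Of` (p508140);
* **`SharpCutU.cor312PerImageOf_of_not_sharp`** — off the cut, `T.Cor312PerImageOf` (reading (P)): at a rational point `d_mod = 1`
  (`Cor22.dmod_eq_one_of_degree_le_one`, `degree_ratPoint`, abc-iut-S-d2 `finrank_rat_fieldOfModuli_eq_dmod`), where the two readings are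
  ONE claim (abc-iut-c312-d1 `DHData.cor312Of_iff_perImage_of_finrank_eq_one`);
* **`SharpCutU.pilotKummerCompatHull_of_not_sharp`** — off the cut, S_H (pinned reading) at the K books' setting with the chosen realising
  ideles, for ANY context / column data and ANY `qK`: abc-iut-W-row-1's socket `WRow.licence_triple_unconditional` with p508140's `hcell`
  theorems, then gen 5's `Cor312Prov.pilotKummerCompatHull_iff_licence_settingPrVolSharp_pilotDataOfK` (S_H ≡ (xi-f) licence, p485141).

HONEST SCOPE (numbers, not adjectives): degree-1 Frey points `λ = a/c ∈ (0,1)` of abc triples with `j ≠ 1728` only (no socket at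
`λ ∉ (0,1)`, at `j = 1728`, or in degree `≥ 2` — there the books keep the window `l < L(P)` of gen 6 or no cut); OUR sharp containers and
Dupuy–Hilado's typed (Ind1)/(Ind2); the M books' S_H binder (M-level setting) is NOT served (p508140 is a K-setting licence). A cut
discharges nothing: explicit hypothesis counts of every book are UNCHANGED by the files that use these junctions. Typed ≠ proved;
instantiated ≠ endorsed; no abc claim. [cite: Mochizuki2012, IUTchI Def. 3.1 (b),(c) pp. 61–62, Ex. 3.2 (iv) p. 71; IUTchIII Cor. 3.12
p. 173–174, Step (xi-f) p. 184; IUTchIV Thm. 1.10 p. 22, Prop. 1.2 (i)(ii) p. 10, Prop. 1.4 (ii) p. 13, Cor. 2.2 (ii) proof (P5) p. 46]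
[cite: DupuyHilado2025, §3.3, §3.9, §4.9, §4.12] [claim: Mochizuki2012, status: disputed] for every IUT sentence. PROOF-ONLY: no definitions.
-/

noncomputable section

open Set Function NumberField IsDedekindDomain

namespace Summit.ABC.IUTFork.Conditional

open Thm311 Thm311.Real Cor312 Cor312Vol Cor312Prov Literature.IUT.LogThetaLattice Literature.IUT.LogVolume
  Literature.IUT.HodgeTheaters Literature.IUT.LogVolume.ThetaData Literature.IUT.LogVolume.Cor22
open Literature.NumberTheory.NumberFields Literature.NumberTheory.GaloisRepresentations.Ultrametric
open Literature.NumberTheory.DiophantineGeometry Literature.NumberTheory.DiophantineGeometry.GenEll Summit.ABC.ABC.Theorems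

/-! ## §1. Off the sharp cut: the (U) number-level Corollary, and the per-image one -/

/-- **Off the SHARP LEVEL CUT, `T.Cor312Of` is a THEOREM**: if it is NOT the case that «whenever `P` is the Frey point of an abc triple
with `j ≠ 1728`, `l ≤ 4·Nat.sqrt(abc) + 4` and some odd prime `p ∣ abc` has `l ≤ max p (4·p^{⌊v_p(abc)/2⌋})`», then `P = ratPoint (a/c)`
for such a triple and `l` is beyond one of the two thresholds — p508140's `WRow.cor312Of_triple_eventually_sqrt` /
`WRow.cor312Of_triple_of_primePow_lt`. [cite: Mochizuki2012, IUTchIII Cor. 3.12 p. 173–174; IUTchIV Prop. 1.2 (i)(ii) p. 10, Prop. 1.4 (ii)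
p. 13] [claim: Mochizuki2012, status: disputed] -/
theorem SharpCutU.cor312Of_of_not_sharp {P : NFPoint} {l : ℕ} (hl : l.Prime) (h5 : 5 ≤ l)
    (hs : ¬ ∀ a b c : ℕ, IsABCTriple a b c → Cor22.jInv ((a : ℚ) / c) ≠ 1728 → P = ratPoint ((a : ℚ) / c) →
        l ≤ 4 * Nat.sqrt (a * b * c) + 4 ∧
          ∃ p : ℕ, p.Prime ∧ p ∣ a * b * c ∧ p ≠ 2 ∧ l ≤ max p (4 * p ^ ((a * b * c).factorization p / 2)))
    (T : Cor22.ThetaVolumeDatumAt P l) : T.Cor312Of := by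
  push Not at hs
  obtain ⟨a, b, c, habc, hj, rfl, hor⟩ := hs
  by_cases h4 : 4 * Nat.sqrt (a * b * c) + 5 ≤ l
  · exact WRow.cor312Of_triple_eventually_sqrt habc hj l hl h4 T
  · exact WRow.cor312Of_triple_of_primePow_lt habc hj hl h5
      (fun p hp hpd hp2 => max_lt_iff.1 (hor (by omega) p hp hpd hp2)) T

/-- **Off the SHARP LEVEL CUT, `T.Cor312PerImageOf` (reading (P)) is a THEOREM**: the point is `ratPoint (a/c)`, of degree `1`, so
`d_mod = 1` and `[F_mod : ℚ] = 1` at the datum, where the per-image Corollary IS the (U) one (abc-iut-c312-d1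
`DHData.cor312Of_iff_perImage_of_finrank_eq_one`). [cite: Mochizuki2012, IUTchIII Cor. 3.12 p. 174; IUTchIV Thm. 1.10 p. 22]
[claim: Mochizuki2012, status: disputed] -/
theorem SharpCutU.cor312PerImageOf_of_not_sharp {P : NFPoint} {l : ℕ} (hl : l.Prime) (h5 : 5 ≤ l)
    (hs : ¬ ∀ a b c : ℕ, IsABCTriple a b c → Cor22.jInv ((a : ℚ) / c) ≠ 1728 → P = ratPoint ((a : ℚ) / c) →
        l ≤ 4 * Nat.sqrt (a * b * c) + 4 ∧
          ∃ p : ℕ, p.Prime ∧ p ∣ a * b * c ∧ p ≠ 2 ∧ l ≤ max p (4 * p ^ ((a * b * c).factorization p / 2)))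
    (T : Cor22.ThetaVolumeDatumAt P l) : T.Cor312PerImageOf := by
  have hU := SharpCutU.cor312Of_of_not_sharp hl h5 hs T
  push Not at hs
  obtain ⟨a, b, c, -, -, rfl, -⟩ := hs
  letI := T.instFieldF; letI := T.instNumberFieldF; letI := T.instAlgebraF; letI := T.instFieldK
  letI := T.instNumberFieldK; letI := T.instAlgebraK; letI := T.instFieldFbar; letI := T.instAlgebraFbar
  letI := T.instAlgebraKFbar; letI := T.instIsElliptic
  have hF : Module.finrank ℚ (fieldOfModuli T.E) = 1 :=
    T.finrank_rat_fieldOfModuli_eq_dmod.trans (Cor22.dmod_eq_one_of_degree_le_one (le_of_eq (degree_ratPoint _)))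
  exact (DHData.cor312Of_iff_perImage_of_finrank_eq_one T.I hF).mp hU

/-! ## §2. Off the sharp cut: S_H (pinned reading) at the K books' setting, ANY context / column data, ANY `qK` -/

section Family

/-! ### DATA — the K books' per-datum context and column binders, VERBATIM as p460293 / p462946 -/

variable
    (M : ∀ (P : NFPoint) (l : ℕ) (T : Cor22.ThetaVolumeDatumAt P l), Type) [∀ P l T, Field (M P l T)] [∀ P l T, NumberField (M P l T)]
    (archPk : ∀ (P : NFPoint) (l : ℕ) (T : Cor22.ThetaVolumeDatumAt P l), letI := T.instFieldF; letI := T.instNumberFieldF; letI := T.instAlgebraF; letI := T.instFieldK;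
        letI := T.instNumberFieldK; letI := T.instAlgebraK; letI := T.instFieldFbar; letI := T.instAlgebraFbar;
        letI := T.instAlgebraKFbar; letI := T.instIsElliptic;
      ∀ (j : (thetaIndex (pilotDataOfK T.D T.K)).Label) (vQ : (thetaIndex (pilotDataOfK T.D T.K)).VQ), Set ((logShellsDH (pilotDataOfK T.D T.K) (analyticLogv T.K)).Packet j vQ))
    (archSub : ∀ (P : NFPoint) (l : ℕ) (T : Cor22.ThetaVolumeDatumAt P l), letI := T.instFieldF; letI := T.instNumberFieldF; letI := T.instAlgebraF; letI := T.instFieldK;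
        letI := T.instNumberFieldK; letI := T.instAlgebraK; letI := T.instFieldFbar; letI := T.instAlgebraFbar;
        letI := T.instAlgebraKFbar; letI := T.instIsElliptic;
      ∀ (j : (thetaIndex (pilotDataOfK T.D T.K)).Label) (v : (thetaIndex (pilotDataOfK T.D T.K)).V), Set ((logShellsDH (pilotDataOfK T.D T.K) (analyticLogv T.K)).Packet j ((thetaIndex (pilotDataOfK T.D T.K)).over v)))
    (Ψ : ∀ (P : NFPoint) (l : ℕ) (T : Cor22.ThetaVolumeDatumAt P l), letI := T.instFieldF; letI := T.instNumberFieldF; letI := T.instAlgebraF; letI := T.instFieldK;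
        letI := T.instNumberFieldK; letI := T.instAlgebraK; letI := T.instFieldFbar; letI := T.instAlgebraFbar;
        letI := T.instAlgebraKFbar; letI := T.instIsElliptic;
      ℤ → ∀ v : (thetaIndex (pilotDataOfK T.D T.K)).V, v ∈ (thetaIndex (pilotDataOfK T.D T.K)).Vbad → Set ((logShellsDH (pilotDataOfK T.D T.K) (analyticLogv T.K)).StarPacket v))
    (act : ∀ (P : NFPoint) (l : ℕ) (T : Cor22.ThetaVolumeDatumAt P l), letI := T.instFieldF; letI := T.instNumberFieldF; letI := T.instAlgebraF; letI := T.instFieldK;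
        letI := T.instNumberFieldK; letI := T.instAlgebraK; letI := T.instFieldFbar; letI := T.instAlgebraFbar;
        letI := T.instAlgebraKFbar; letI := T.instIsElliptic;
      ℤ → ∀ v : (thetaIndex (pilotDataOfK T.D T.K)).V, v ∈ (thetaIndex (pilotDataOfK T.D T.K)).Vbad → (logShellsDH (pilotDataOfK T.D T.K) (analyticLogv T.K)).StarPacket v → Module.End ℚ ((logShellsDH (pilotDataOfK T.D T.K) (analyticLogv T.K)).StarPacket v))
    (Mmod : ∀ (P : NFPoint) (l : ℕ) (T : Cor22.ThetaVolumeDatumAt P l), letI := T.instFieldF; letI := T.instNumberFieldF; letI := T.instAlgebraF; letI := T.instFieldK;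
        letI := T.instNumberFieldK; letI := T.instAlgebraK; letI := T.instFieldFbar; letI := T.instAlgebraFbar;
        letI := T.instAlgebraKFbar; letI := T.instIsElliptic;
      ℤ → ∀ j : (thetaIndex (pilotDataOfK T.D T.K)).LabelStar, Set ((logShellsDH (pilotDataOfK T.D T.K) (analyticLogv T.K)).GlobalPacket j.1))
    (region : ∀ (P : NFPoint) (l : ℕ) (T : Cor22.ThetaVolumeDatumAt P l), letI := T.instFieldF; letI := T.instNumberFieldF; letI := T.instAlgebraF; letI := T.instFieldK;
        letI := T.instNumberFieldK; letI := T.instAlgebraK; letI := T.instFieldFbar; letI := T.instAlgebraFbar;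
        letI := T.instAlgebraKFbar; letI := T.instIsElliptic;
      ℤ → ∀ j : (thetaIndex (pilotDataOfK T.D T.K)).LabelStar, FinDivisor (M P l T) → ∀ vQ : (thetaIndex (pilotDataOfK T.D T.K)).VQ, Set ((logShellsDH (pilotDataOfK T.D T.K) (analyticLogv T.K)).Packet j.1 vQ))
    (frobAdm : ∀ (P : NFPoint) (l : ℕ) (T : Cor22.ThetaVolumeDatumAt P l), letI := T.instFieldF; letI := T.instNumberFieldF; letI := T.instAlgebraF; letI := T.instFieldK;
        letI := T.instNumberFieldK; letI := T.instAlgebraK; letI := T.instFieldFbar; letI := T.instAlgebraFbar;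
        letI := T.instAlgebraKFbar; letI := T.instIsElliptic;
      ℤ → ℤ → ∀ (j : (thetaIndex (pilotDataOfK T.D T.K)).Label) (vQ : (thetaIndex (pilotDataOfK T.D T.K)).VQ), Set ((logShellsDH (pilotDataOfK T.D T.K) (analyticLogv T.K)).Packet j vQ) → Prop)
    (frobLogvol : ∀ (P : NFPoint) (l : ℕ) (T : Cor22.ThetaVolumeDatumAt P l), letI := T.instFieldF; letI := T.instNumberFieldF; letI := T.instAlgebraF; letI := T.instFieldK;
        letI := T.instNumberFieldK; letI := T.instAlgebraK; letI := T.instFieldFbar; letI := T.instAlgebraFbar;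
        letI := T.instAlgebraKFbar; letI := T.instIsElliptic;
      ℤ → ℤ → ∀ (j : (thetaIndex (pilotDataOfK T.D T.K)).Label) (vQ : (thetaIndex (pilotDataOfK T.D T.K)).VQ), Set ((logShellsDH (pilotDataOfK T.D T.K) (analyticLogv T.K)).Packet j vQ) → ℝ)
    (frobΨ : ∀ (P : NFPoint) (l : ℕ) (T : Cor22.ThetaVolumeDatumAt P l), letI := T.instFieldF; letI := T.instNumberFieldF; letI := T.instAlgebraF; letI := T.instFieldK;
        letI := T.instNumberFieldK; letI := T.instAlgebraK; letI := T.instFieldFbar; letI := T.instAlgebraFbar;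
        letI := T.instAlgebraKFbar; letI := T.instIsElliptic;
      ℤ → ℤ → ∀ v : (thetaIndex (pilotDataOfK T.D T.K)).V, v ∈ (thetaIndex (pilotDataOfK T.D T.K)).Vbad → Set ((logShellsDH (pilotDataOfK T.D T.K) (analyticLogv T.K)).StarPacket v))
    (frobMmod : ∀ (P : NFPoint) (l : ℕ) (T : Cor22.ThetaVolumeDatumAt P l), letI := T.instFieldF; letI := T.instNumberFieldF; letI := T.instAlgebraF; letI := T.instFieldK;
        letI := T.instNumberFieldK; letI := T.instAlgebraK; letI := T.instFieldFbar; letI := T.instAlgebraFbar;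
        letI := T.instAlgebraKFbar; letI := T.instIsElliptic;
      ℤ → ℤ → ∀ j : (thetaIndex (pilotDataOfK T.D T.K)).LabelStar, Set ((logShellsDH (pilotDataOfK T.D T.K) (analyticLogv T.K)).GlobalPacket j.1))
    (unitImage : ∀ (P : NFPoint) (l : ℕ) (T : Cor22.ThetaVolumeDatumAt P l), letI := T.instFieldF; letI := T.instNumberFieldF; letI := T.instAlgebraF; letI := T.instFieldK;
        letI := T.instNumberFieldK; letI := T.instAlgebraK; letI := T.instFieldFbar; letI := T.instAlgebraFbar;
        letI := T.instAlgebraKFbar; letI := T.instIsElliptic;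
      ℤ → ℤ → ℕ → ∀ (j : (thetaIndex (pilotDataOfK T.D T.K)).Label) (vQ : (thetaIndex (pilotDataOfK T.D T.K)).VQ), Set ((logShellsDH (pilotDataOfK T.D T.K) (analyticLogv T.K)).Packet j vQ))
    (ballImage : ∀ (P : NFPoint) (l : ℕ) (T : Cor22.ThetaVolumeDatumAt P l), letI := T.instFieldF; letI := T.instNumberFieldF; letI := T.instAlgebraF; letI := T.instFieldK;
        letI := T.instNumberFieldK; letI := T.instAlgebraK; letI := T.instFieldFbar; letI := T.instAlgebraFbar;
        letI := T.instAlgebraKFbar; letI := T.instIsElliptic;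
      ℤ → ℤ → ∀ (j : (thetaIndex (pilotDataOfK T.D T.K)).Label) (vQ : (thetaIndex (pilotDataOfK T.D T.K)).VQ), Set ((logShellsDH (pilotDataOfK T.D T.K) (analyticLogv T.K)).Packet j vQ))
    (thetaDiv : ∀ (P : NFPoint) (l : ℕ) (T : Cor22.ThetaVolumeDatumAt P l), letI := T.instFieldF; letI := T.instNumberFieldF; letI := T.instAlgebraF; letI := T.instFieldK;
        letI := T.instNumberFieldK; letI := T.instAlgebraK; letI := T.instFieldFbar; letI := T.instAlgebraFbar;
        letI := T.instAlgebraKFbar; letI := T.instIsElliptic;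
      ℤ → ℤ → LgpDivisor (M P l T) (thetaIndex (pilotDataOfK T.D T.K)).lstar)
    (n : ∀ (P : NFPoint) (l : ℕ) (T : Cor22.ThetaVolumeDatumAt P l), ℤ)
    {HT : ∀ (P : NFPoint) (l : ℕ) (T : Cor22.ThetaVolumeDatumAt P l), Type} {LogLink : ∀ (P : NFPoint) (l : ℕ) (T : Cor22.ThetaVolumeDatumAt P l), HT P l T → HT P l T → Type}
    {IsFull : ∀ (P : NFPoint) (l : ℕ) (T : Cor22.ThetaVolumeDatumAt P l), ∀ {s t : HT P l T}, LogLink P l T s t → Prop}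
    (lat : ∀ (P : NFPoint) (l : ℕ) (T : Cor22.ThetaVolumeDatumAt P l), LGPGaussianLogThetaLattice (LogLink P l T) (IsFull P l T))
    {Frd : ∀ (P : NFPoint) (l : ℕ) (T : Cor22.ThetaVolumeDatumAt P l), Type} {IsoF : ∀ (P : NFPoint) (l : ℕ) (T : Cor22.ThetaVolumeDatumAt P l), Frd P l T → Frd P l T → Type} {Ob : ∀ (P : NFPoint) (l : ℕ) (T : Cor22.ThetaVolumeDatumAt P l), Frd P l T → Type}
    {realify : ∀ (P : NFPoint) (l : ℕ) (T : Cor22.ThetaVolumeDatumAt P l), Frd P l T → Frd P l T} {Strip : ∀ (P : NFPoint) (l : ℕ) (T : Cor22.ThetaVolumeDatumAt P l), Type} {IsoS : ∀ (P : NFPoint) (l : ℕ) (T : Cor22.ThetaVolumeDatumAt P l), Strip P l T → Strip P l T → Type}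
    {Mv : ∀ (P : NFPoint) (l : ℕ) (T : Cor22.ThetaVolumeDatumAt P l), letI := T.instFieldF; letI := T.instNumberFieldF; letI := T.instAlgebraF; letI := T.instFieldK;
        letI := T.instNumberFieldK; letI := T.instAlgebraK; letI := T.instFieldFbar; letI := T.instAlgebraFbar;
        letI := T.instAlgebraKFbar; letI := T.instIsElliptic;
      ∀ v : (thetaIndex (pilotDataOfK T.D T.K)).V, v ∈ (thetaIndex (pilotDataOfK T.D T.K)).Vbad → Type}
    [∀ P l T v h, Monoid (Mv P l T v h)]
    (sig : ∀ (P : NFPoint) (l : ℕ) (T : Cor22.ThetaVolumeDatumAt P l), letI := T.instFieldF; letI := T.instNumberFieldF; letI := T.instAlgebraF; letI := T.instFieldK;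
        letI := T.instNumberFieldK; letI := T.instAlgebraK; letI := T.instFieldFbar; letI := T.instAlgebraFbar;
        letI := T.instAlgebraKFbar; letI := T.instIsElliptic;
      GlobalLGPFrobenioidSignature (thetaIndex (pilotDataOfK T.D T.K)).lstar (thetaIndex (pilotDataOfK T.D T.K)).V (· ∈ (thetaIndex (pilotDataOfK T.D T.K)).Vbad) (Frd P l T) (IsoF P l T) (Ob P l T) (realify P l T)
        (Strip P l T) (IsoS P l T) (Mv P l T))
    (split : ∀ (P : NFPoint) (l : ℕ) (T : Cor22.ThetaVolumeDatumAt P l), SplittingMonoids (Mv P l T))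
    {ObΔ : ∀ (P : NFPoint) (l : ℕ) (T : Cor22.ThetaVolumeDatumAt P l), Type} {N : ∀ (P : NFPoint) (l : ℕ) (T : Cor22.ThetaVolumeDatumAt P l), letI := T.instFieldF; letI := T.instNumberFieldF; letI := T.instAlgebraF; letI := T.instFieldK;
        letI := T.instNumberFieldK; letI := T.instAlgebraK; letI := T.instFieldFbar; letI := T.instAlgebraFbar;
        letI := T.instAlgebraKFbar; letI := T.instIsElliptic;
      ∀ v : (thetaIndex (pilotDataOfK T.D T.K)).V, v ∈ (thetaIndex (pilotDataOfK T.D T.K)).Vbad → Type}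
    [∀ P l T v h, Monoid (N P l T v h)] (qData : ∀ (P : NFPoint) (l : ℕ) (T : Cor22.ThetaVolumeDatumAt P l), QPilotData (ObΔ P l T) (N P l T))
    (qK : ∀ (P : NFPoint) (l : ℕ) (T : Cor22.ThetaVolumeDatumAt P l), letI := T.instFieldF; letI := T.instNumberFieldF; letI := T.instAlgebraF; letI := T.instFieldK;
        letI := T.instNumberFieldK; letI := T.instAlgebraK; letI := T.instFieldFbar; letI := T.instAlgebraFbar;
        letI := T.instAlgebraKFbar; letI := T.instIsElliptic;
      ∀ v : (thetaIndex (pilotDataOfK T.D T.K)).V, v ∈ (thetaIndex (pilotDataOfK T.D T.K)).Vbad → Set ((logShellsDH (pilotDataOfK T.D T.K) (analyticLogv T.K)).StarPacket v))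

/-- **Off the SHARP LEVEL CUT, S_H (pinned reading; the K books' sharp setting with the CHOSEN realising ideles) is a THEOREM** for
ANY context / column data and ANY `qK`: abc-iut-W-row-1's triple socket `WRow.licence_triple_unconditional` (envelope exponents
`A_p = B_p = ⌊v_p(abc)/2⌋`) with p508140's `WRow.hcell_triple_of_sq_lt` (beyond `4·√(abc) + 4`) or `WRow.hcell_triple_of_primePow_lt`
(beyond every odd bad `p` and its `4·p^{⌊v_p/2⌋}`) gives the (xi-f) licence at the chosen ideles; gen 5's
`Cor312Prov.pilotKummerCompatHull_iff_licence_settingPrVolSharp_pilotDataOfK` (p485141) turns it into S_H. [cite: Mochizuki2012, IUTchI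
Def. 3.1 (b),(c) pp. 61–62; IUTchIII Cor. 3.12 Step (xi-f) p. 184; IUTchIV Prop. 1.2 (i)(ii) p. 10, Prop. 1.4 (ii) p. 13]
[cite: DupuyHilado2025, §3.3, §3.9, §4.9, §4.12] [claim: Mochizuki2012, status: disputed] -/
theorem SharpCutU.pilotKummerCompatHull_of_not_sharp {P : NFPoint} {l : ℕ} (hl : l.Prime) (h5 : 5 ≤ l)
    (hs : ¬ ∀ a b c : ℕ, IsABCTriple a b c → Cor22.jInv ((a : ℚ) / c) ≠ 1728 → P = ratPoint ((a : ℚ) / c) →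
        l ≤ 4 * Nat.sqrt (a * b * c) + 4 ∧
          ∃ p : ℕ, p.Prime ∧ p ∣ a * b * c ∧ p ≠ 2 ∧ l ≤ max p (4 * p ^ ((a * b * c).factorization p / 2)))
    (T : Cor22.ThetaVolumeDatumAt P l) :
    letI := T.instFieldF; letI := T.instNumberFieldF; letI := T.instAlgebraF; letI := T.instFieldK;
        letI := T.instNumberFieldK; letI := T.instAlgebraK; letI := T.instFieldFbar; letI := T.instAlgebraFbar;
        letI := T.instAlgebraKFbar; letI := T.instIsElliptic;
      Cor312Vol.PilotKummerCompatHull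
        (LatticeSituation.ofShells (logShellsDH (pilotDataOfK T.D T.K) (analyticLogv T.K)) (M P l T) (archPk P l T)
          (archSub P l T) (summandPiecesPr (pilotDataOfK T.D T.K) (logvAnalytic_analyticLogv (F := T.K))).Adm
          (summandPiecesPr (pilotDataOfK T.D T.K) (logvAnalytic_analyticLogv (F := T.K))).logvol (Ψ P l T) (act P l T) (Mmod P l T)
          (region P l T) (frobAdm P l T) (frobLogvol P l T) (frobΨ P l T) (frobMmod P l T) (unitImage P l T)
          (ballImage P l T) (thetaDiv P l T))
        (settingPrVolSharp (pilotDataOfK T.D T.K) (logvAnalytic_analyticLogv (F := T.K)) (M P l T) (archPk P l T) (archSub P l T) (Ψ P l T)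
          (act P l T) (Mmod P l T) (region P l T) (n P l T) (lat P l T) (sig P l T) (split P l T) (qData P l T)
          (exists_realising_qIdeles_pilotDataOfK T.D).choose
          (exists_realising_thetaIdeles_pilotDataOfK T.D).choose
          (exists_realising_qIdeles_pilotDataOfK T.D).choose_spec.1
          (exists_realising_qIdeles_pilotDataOfK T.D).choose_spec.2.1)
        (fun _ => Cor312.Setting.qRegion
        (settingPrVolSharp (pilotDataOfK T.D T.K) (logvAnalytic_analyticLogv (F := T.K)) (M P l T) (archPk P l T) (archSub P l T) (Ψ P l T)
          (act P l T) (Mmod P l T) (region P l T) (n P l T) (lat P l T) (sig P l T) (split P l T) (qData P l T)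
          (exists_realising_qIdeles_pilotDataOfK T.D).choose
          (exists_realising_thetaIdeles_pilotDataOfK T.D).choose
          (exists_realising_qIdeles_pilotDataOfK T.D).choose_spec.1
          (exists_realising_qIdeles_pilotDataOfK T.D).choose_spec.2.1)) (qK P l T) := by
  push Not at hs
  obtain ⟨a, b, c, habc, hj, rfl, hor⟩ := hs
  letI := T.instFieldF; letI := T.instNumberFieldF; letI := T.instAlgebraF; letI := T.instFieldK
  letI := T.instNumberFieldK; letI := T.instAlgebraK; letI := T.instFieldFbar; letI := T.instAlgebraFbar
  letI := T.instAlgebraKFbar; letI := T.instIsElliptic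
  have hL := WRow.licence_triple_unconditional habc hj T (fun p => (a * b * c).factorization p / 2)
    (fun p => (a * b * c).factorization p / 2)
    (by
      by_cases h4 : 4 * Nat.sqrt (a * b * c) + 5 ≤ l
      · refine WRow.hcell_triple_of_sq_lt habc hl ?_
        -- `abc < (√abc + 1)²` and `4(√abc + 1) < l`
        have h1 : a * b * c < (Nat.sqrt (a * b * c) + 1) ^ 2 := Nat.lt_succ_sqrt' (a * b * c)
        have h2 : 4 * (Nat.sqrt (a * b * c) + 1) < l := by omega
        nlinarith [Nat.mul_lt_mul'' h2 h2]
      · exact WRow.hcell_triple_of_primePow_lt habc hl h5 fun p hp hpd hp2 => max_lt_iff.1 (hor (by omega) p hp hpd hp2))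
    (logvAnalytic_analyticLogv (F := T.K)) (M _ l T) (archPk _ l T) (archSub _ l T) (Ψ _ l T) (act _ l T) (Mmod _ l T) (region _ l T)
    (n _ l T) (lat _ l T) (sig _ l T) (split _ l T) (qData _ l T) (exists_realising_qIdeles_pilotDataOfK T.D).choose
    (exists_realising_thetaIdeles_pilotDataOfK T.D).choose (exists_realising_qIdeles_pilotDataOfK T.D).choose_spec.1
    (exists_realising_qIdeles_pilotDataOfK T.D).choose_spec.2.1 (exists_realising_thetaIdeles_pilotDataOfK T.D).choose_spec.1
    (exists_realising_thetaIdeles_pilotDataOfK T.D).choose_spec.2.2 (exists_realising_qIdeles_pilotDataOfK T.D).choose_spec.2.2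
  exact (Cor312Prov.pilotKummerCompatHull_iff_licence_settingPrVolSharp_pilotDataOfK T.D (logvAnalytic_analyticLogv (F := T.K))
    (M _ l T) (archPk _ l T) (archSub _ l T) (Ψ _ l T) (act _ l T) (Mmod _ l T) (region _ l T) (n _ l T) (lat _ l T) (sig _ l T)
    (split _ l T) (qData _ l T) (exists_realising_thetaIdeles_pilotDataOfK T.D).choose (frobAdm _ l T) (frobLogvol _ l T) (frobΨ _ l T)
    (frobMmod _ l T) (unitImage _ l T) (ballImage _ l T) (thetaDiv _ l T) (qK _ l T)
    (exists_realising_thetaIdeles_pilotDataOfK T.D).choose_spec.1).2 hL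

end Family

end Summit.ABC.IUTFork.Conditional

end
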